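import Literature.Computability.QuantumComplexity.ForrelationSignTransport
import Literature.Computability.QuantumComplexity.ForrelationDirectSum

/-!
# Crux `CubicForrelation.SignedCubicForrelationNotPrBPP` (stmt-QuantumAdvantage-13931) — line `Sketch`

Linear-algebra toolkit for the lead's stub `stub_kernelNormalForm` (helper file 2/3): the Boolean
inner product `⟪u, v⟫ = ⊕ᵢ uᵢvᵢ` (so that the character is `twist u v = (-1)^{⟪u,v⟫}`,
`knf_signOf_ip`), its bi-additivity, the expansion of an ADDITIVE map `L : 𝔽₂ᵐ → 𝔽₂` as
`L x = ⟪x, (L eⱼ)ⱼ⟫` (`knf_additive_eq_ip`, registered sub-goal `knf_additive_expansion`), and three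
families of ELEMENTARY coordinate changes of `𝔽₂ᵐ`, as explicit vectors of `Fin m → Bool`:

* transvections `T_{i,κ} x = x ⊕ xᵢ·κ` (used with `κᵢ = 0`),
* their transposes `S_{i,κ} u = u ⊕ ⟪u,κ⟫·eᵢ`,
* coordinate transpositions `P_{a,b} x = x ∘ (a b)`,

each an involution, each additive, and pairwise ADJOINT for the characters —
`twist (S u) (T v) = twist u v`, `twist (P u) (P v) = twist u v` — which is the hypothesis of the
landed `stub_coupledInvariance` (`Φ(a ∘ e', b ∘ e) = Φ(a, b)`); plus the transport rules
`⟪T v, k⟫ = ⟪v, S k⟫` etc. used to follow a linear functional through the coordinate changes.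
No new definitions and no notation: the five gadgets are written out as explicit lambda-terms over
tree vocabulary in every statement (`⟪u,v⟫ = decide (Odd #{ℓ | u ℓ ∧ v ℓ})`, `eⱼ = fun ℓ' => [ℓ' = j]`,
`T_{i,κ} x = fun j' => x j' ⊕ (x i ∧ κ j')`, `S_{i,κ} u = fun j' => u j' ⊕ (⟪u,κ⟫ ∧ [j' = i])`,
`P_{a,b} x = fun j' => x ((a b) j')`). Degree facts live in the sibling file
`…StubKernelNormalFormDegree.lean`.
-/

noncomputable section

set_option linter.dupNamespace false -- D-0017: single-problem summit ⇒ QuantumAdvantage.QuantumAdvantage by design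

namespace Summit.QuantumAdvantage.QuantumAdvantage.Theorems.SignedCubicForrelationNotPrBPP

open Finset Literature.Computability.QuantumComplexity
open Literature.Computability.QuantumComplexity.BuzetChailloux (bxor zeroVec twist_bxor_right)
open Literature.Computability.QuantumComplexity.DerivativeWalsh (twist_bxor_left)
open Literature.Computability.QuantumComplexity.Simon (twist_eq_neg_one_pow twist_xor_left twist_mul_self)

variable {m : ℕ}

/-! ### The inner product and the characters -/

/-- `(-1)^{⟪u,v⟫} = twist u v`. -/
theorem knf_signOf_ip (u v : Fin m → Bool) : signOf (decide (Odd (Finset.card (Finset.filter (fun ℓ => (u ℓ && v ℓ)) Finset.univ)))) = twist u v := by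
  rw [twist_eq_neg_one_pow]
  by_cases h : Odd (univ.filter fun i => u i && v i).card
  · rw [decide_eq_true h, h.neg_one_pow]; rfl
  · rw [decide_eq_false h, (Nat.not_odd_iff_even.1 h).neg_one_pow]; rfl

/-- `signOf a = signOf b ↔ a = b`. -/
theorem knf_signOf_eq_signOf_iff (a b : Bool) : signOf a = signOf b ↔ a = b := by
  cases a <;> cases b <;> norm_num [signOf]

/-- `⟪u, v⟫ = ⟪v, u⟫`. -/
theorem knf_ip_comm (u v : Fin m → Bool) : (decide (Odd (Finset.card (Finset.filter (fun ℓ => (u ℓ && v ℓ)) Finset.univ)))) = (decide (Odd (Finset.card (Finset.filter (fun ℓ => (v ℓ && u ℓ)) Finset.univ)))) :=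
  (knf_signOf_eq_signOf_iff _ _).1 (by rw [knf_signOf_ip, knf_signOf_ip, twist_comm])

/-- Additivity on the left: `⟪u ⊕ u', v⟫ = ⟪u, v⟫ ⊕ ⟪u', v⟫`. -/
theorem knf_ip_bxor_left (u u' v : Fin m → Bool) : (decide (Odd (Finset.card (Finset.filter (fun ℓ => ((bxor u u') ℓ && v ℓ)) Finset.univ)))) = ((decide (Odd (Finset.card (Finset.filter (fun ℓ => (u ℓ && v ℓ)) Finset.univ)))) ^^ (decide (Odd (Finset.card (Finset.filter (fun ℓ => (u' ℓ && v ℓ)) Finset.univ))))) :=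
  (knf_signOf_eq_signOf_iff _ _).1 (by
    rw [signOf_xor, knf_signOf_ip, knf_signOf_ip, knf_signOf_ip]
    exact twist_bxor_left u u' v)

/-- Additivity on the right: `⟪u, v ⊕ v'⟫ = ⟪u, v⟫ ⊕ ⟪u, v'⟫`. -/
theorem knf_ip_bxor_right (u v v' : Fin m → Bool) : (decide (Odd (Finset.card (Finset.filter (fun ℓ => (u ℓ && (bxor v v') ℓ)) Finset.univ)))) = ((decide (Odd (Finset.card (Finset.filter (fun ℓ => (u ℓ && v ℓ)) Finset.univ)))) ^^ (decide (Odd (Finset.card (Finset.filter (fun ℓ => (u ℓ && v' ℓ)) Finset.univ))))) := by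
  rw [knf_ip_comm, knf_ip_bxor_left, knf_ip_comm v, knf_ip_comm v']

/-- `⟪u, eⱼ⟫ = uⱼ`. -/
theorem knf_ip_E_right (u : Fin m → Bool) (j : Fin m) : (decide (Odd (Finset.card (Finset.filter (fun ℓ => (u ℓ && (fun ℓ' => decide (ℓ' = j)) ℓ)) Finset.univ)))) = u j := by
  have hfilter : (univ.filter fun i => u i && decide (i = j)) = if u j then {j} else ∅ := by
    ext i
    simp only [mem_filter, mem_univ, true_and, Bool.and_eq_true, decide_eq_true_eq]
    split_ifs with h
    · rw [mem_singleton]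
      exact ⟨fun hi => hi.2, fun hi => ⟨hi ▸ h, hi⟩⟩
    · simp only [Finset.notMem_empty, iff_false, not_and]
      intro hi hij
      rw [hij] at hi
      exact h hi
  rw [hfilter]
  cases u j <;> simp

/-- `⟪eⱼ, v⟫ = vⱼ`. -/
theorem knf_ip_E_left (v : Fin m → Bool) (j : Fin m) : (decide (Odd (Finset.card (Finset.filter (fun ℓ => ((fun ℓ' => decide (ℓ' = j)) ℓ && v ℓ)) Finset.univ)))) = v j := by
  rw [knf_ip_comm, knf_ip_E_right]

/-- `⟪u, 0⟫ = 0`. -/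
theorem knf_ip_zero_right (u : Fin m → Bool) : (decide (Odd (Finset.card (Finset.filter (fun ℓ => (u ℓ && (zeroVec : Fin m → Bool) ℓ)) Finset.univ)))) = false := by
  have : (univ.filter fun i => u i && (zeroVec : Fin m → Bool) i) = ∅ :=
    filter_false_of_mem fun i _ => by simp [zeroVec]
  rw [this]; rfl

/-- `⟪0, v⟫ = 0`. -/
theorem knf_ip_zero_left (v : Fin m → Bool) : (decide (Odd (Finset.card (Finset.filter (fun ℓ => ((zeroVec : Fin m → Bool) ℓ && v ℓ)) Finset.univ)))) = false := by
  rw [knf_ip_comm, knf_ip_zero_right]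

/-- `⟪u, c·v⟫ = c ∧ ⟪u, v⟫` for a scalar bit `c`. -/
theorem knf_ip_smul_right (u v : Fin m → Bool) (c : Bool) :
    (decide (Odd (Finset.card (Finset.filter (fun ℓ => (u ℓ && (fun i => c && v i) ℓ)) Finset.univ)))) = (c && (decide (Odd (Finset.card (Finset.filter (fun ℓ => (u ℓ && v ℓ)) Finset.univ))))) := by
  cases c
  · exact knf_ip_zero_right u
  · simp

/-- The character of a scalar multiple: `twist u (c·v) = if c then twist u v else 1`. -/
theorem knf_twist_smul_right (u v : Fin m → Bool) (c : Bool) :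
    twist u (fun i => c && v i) = if c then twist u v else 1 := by
  cases c
  · exact BuzetChailloux.twist_zeroVec_right u
  · have hv : (fun i => true && v i) = v := funext fun i => Bool.true_and (v i)
    rw [hv, if_pos rfl]

/-- `twist v eᵢ = (-1)^{vᵢ}`. -/
theorem knf_twist_E_right (v : Fin m → Bool) (i : Fin m) : twist v (fun ℓ' => decide (ℓ' = i)) = signOf (v i) := by
  rw [← knf_signOf_ip, knf_ip_E_right]

/-- Splitting the inner product along `Fin.cons`. -/
theorem knf_ip_cons {k : ℕ} (a b : Bool) (t w : Fin k → Bool) :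
    (decide (Odd (Finset.card (Finset.filter (fun ℓ => ((Fin.cons a t : Fin (k + 1) → Bool) ℓ && (Fin.cons b w : Fin (k + 1) → Bool) ℓ)) Finset.univ)))) = ((a && b) ^^ (decide (Odd (Finset.card (Finset.filter (fun ℓ => (t ℓ && w ℓ)) Finset.univ))))) := by
  refine (knf_signOf_eq_signOf_iff _ _).1 ?_
  rw [signOf_xor, knf_signOf_ip, knf_signOf_ip]
  unfold twist
  rw [Fin.prod_univ_succ]
  simp only [Fin.cons_zero, Fin.cons_succ]
  cases a <;> cases b <;> simp [signOf]

/-! ### Additive maps are inner products -/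

/-- An additive map kills `0`. -/
theorem knf_additive_zero {L : (Fin m → Bool) → Bool} (hL : ∀ x y, L (bxor x y) = (L x ^^ L y)) :
    L zeroVec = false := by
  have h := hL zeroVec zeroVec
  rw [BuzetChailloux.bxor_self] at h
  revert h; cases L zeroVec <;> simp

/-- **Expansion of additive maps.** If `L : 𝔽₂ᵐ → 𝔽₂` is additive then `L x = ⟪x, (L eⱼ)ⱼ⟫`. -/
theorem knf_additive_eq_ip : ∀ {m : ℕ} {L : (Fin m → Bool) → Bool},
    (∀ x y, L (bxor x y) = (L x ^^ L y)) → ∀ x, L x = (decide (Odd (Finset.card (Finset.filter (fun ℓ => (x ℓ && (fun j => L (fun ℓ' => decide (ℓ' = j))) ℓ)) Finset.univ))))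
  | 0, L, hL, x => by
      have hx : x = zeroVec := funext fun i => i.elim0
      rw [hx, knf_additive_zero hL, knf_ip_zero_left]
  | m + 1, L, hL, x => by
      -- split `x = (x₀·e₀) ⊕ (0, tail x)`
      have hsplit : x = bxor (fun i => x 0 && ((fun ℓ' => decide (ℓ' = (0 : Fin (m + 1))))) i) (Fin.cons false (Fin.tail x)) := by
        funext i
        refine Fin.cases ?_ (fun j => ?_) i
        · simp [bxor]
        · simp [bxor, Fin.tail, Fin.succ_ne_zero j]
      -- the restriction of `L` to `x₀ = 0` is additive on `m` bits
      have hL' : ∀ t w : Fin m → Bool, L (Fin.cons false (bxor t w)) =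
          (L (Fin.cons false t) ^^ L (Fin.cons false w)) := by
        intro t w
        rw [← hL]
        congr 1
        funext i
        refine Fin.cases ?_ (fun j => ?_) i <;> simp [bxor]
      have IH := @knf_additive_eq_ip m (fun t => L (Fin.cons false t)) hL' (Fin.tail x)
      -- value on the first summand
      have hLs : L (fun i => x 0 && ((fun ℓ' => decide (ℓ' = (0 : Fin (m + 1))))) i) = (x 0 && L (fun ℓ' => decide (ℓ' = (0 : Fin (m + 1))))) := by
        cases x 0
        · have : (fun i => false && ((fun ℓ' => decide (ℓ' = (0 : Fin (m + 1))))) i) = zeroVec := by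
            funext i; simp [zeroVec]
          rw [this, knf_additive_zero hL, Bool.false_and]
        · simp
      -- the coefficient vector splits along `Fin.cons`
      have hk : (fun j : Fin (m + 1) => L (fun ℓ' => decide (ℓ' = j))) =
          Fin.cons (L (fun ℓ' => decide (ℓ' = (0 : Fin (m + 1))))) (fun j : Fin m => L (Fin.cons false (fun ℓ' => decide (ℓ' = j)))) := by
        funext j
        refine Fin.cases ?_ (fun i => ?_) j
        · simp
        · simp only [Fin.cons_succ]
          congr 1
          funext l
          refine Fin.cases ?_ (fun l' => ?_) l
          · simp [(Fin.succ_ne_zero i).symm]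
          · simp [Fin.succ_inj]
      have hx : x = Fin.cons (x 0) (Fin.tail x) := (Fin.cons_self_tail x).symm
      conv_lhs => rw [hsplit, hL, hLs]
      conv_rhs => rw [hx, hk, knf_ip_cons]
      simp only [IH]

/-- **Registered sub-goal `knf_additive_expansion` (helper of `stub_kernelNormalForm`).** An additive
map `𝔽₂ᵐ → 𝔽₂` is the inner product with its vector of values on the unit vectors. -/
theorem knf_additive_expansion :
    ∀ (m : ℕ) (L : (Fin m → Bool) → Bool), (∀ x y, L (bxor x y) = (L x ^^ L y)) →
      ∀ x, L x = decide (Odd (Finset.univ.filter fun i => x i && L (fun l => decide (l = i))).card) :=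
  fun _ _ hL x => knf_additive_eq_ip hL x

/-! ### Elementary coordinate changes: involutive and additive -/

/-- `T_{i,κ} x = x ⊕ xᵢ·κ` as an xor. -/
theorem knfT_eq_bxor (i : Fin m) (κ x : Fin m → Bool) : (fun j' => (x j' ^^ (x i && κ j'))) = bxor x (fun j => x i && κ j) := rfl

/-- `S_{i,κ} u = u ⊕ ⟪u,κ⟫·eᵢ` as an xor. -/
theorem knfS_eq_bxor (i : Fin m) (κ u : Fin m → Bool) :
    (fun j' => (u j' ^^ ((decide (Odd (Finset.card (Finset.filter (fun ℓ => (u ℓ && κ ℓ)) Finset.univ)))) && decide (j' = i)))) = bxor u (fun j => (decide (Odd (Finset.card (Finset.filter (fun ℓ => (u ℓ && κ ℓ)) Finset.univ)))) && ((fun ℓ' => decide (ℓ' = i))) j) := rfl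

/-- `T_{i,κ}` does not move the `i`-th coordinate when `κᵢ = 0`. -/
theorem knfT_apply_self {i : Fin m} {κ : Fin m → Bool} (hκ : κ i = false) (x : Fin m → Bool) :
    ((fun j' => (x j' ^^ (x i && κ j')))) i = x i := by
  simp [hκ]

/-- `T_{i,κ}` is an involution when `κᵢ = 0`. -/
theorem knfT_knfT {i : Fin m} {κ : Fin m → Bool} (hκ : κ i = false) (x : Fin m → Bool) :
    (fun j' => ((fun j' => (x j' ^^ (x i && κ j'))) j' ^^ ((fun j' => (x j' ^^ (x i && κ j'))) i && κ j'))) = x := by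
  funext j
  simp only [hκ, Bool.and_false, Bool.xor_false]
  cases x j <;> cases x i <;> cases κ j <;> rfl

/-- `⟪S_{i,κ} u, κ⟫ = ⟪u, κ⟫` when `κᵢ = 0`. -/
theorem knf_ip_knfS_self {i : Fin m} {κ : Fin m → Bool} (hκ : κ i = false) (u : Fin m → Bool) :
    (decide (Odd (Finset.card (Finset.filter (fun ℓ => ((fun j' => (u j' ^^ ((decide (Odd (Finset.card (Finset.filter (fun ℓ => (u ℓ && κ ℓ)) Finset.univ)))) && decide (j' = i)))) ℓ && κ ℓ)) Finset.univ)))) = (decide (Odd (Finset.card (Finset.filter (fun ℓ => (u ℓ && κ ℓ)) Finset.univ)))) := by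
  rw [knfS_eq_bxor, knf_ip_bxor_left]
  have : (decide (Odd (Finset.card (Finset.filter (fun ℓ => ((fun j => (decide (Odd (Finset.card (Finset.filter (fun ℓ => (u ℓ && κ ℓ)) Finset.univ)))) && ((fun ℓ' => decide (ℓ' = i))) j) ℓ && κ ℓ)) Finset.univ)))) = false := by
    rw [knf_ip_comm, knf_ip_smul_right, knf_ip_E_right, hκ, Bool.and_false]
  rw [this, Bool.xor_false]

/-- `S_{i,κ}` is an involution when `κᵢ = 0`. -/
theorem knfS_knfS {i : Fin m} {κ : Fin m → Bool} (hκ : κ i = false) (u : Fin m → Bool) :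
    (fun j' => ((fun j' => (u j' ^^ ((decide (Odd (Finset.card (Finset.filter (fun ℓ => (u ℓ && κ ℓ)) Finset.univ)))) && decide (j' = i)))) j' ^^ ((decide (Odd (Finset.card (Finset.filter (fun ℓ => ((fun j' => (u j' ^^ ((decide (Odd (Finset.card (Finset.filter (fun ℓ => (u ℓ && κ ℓ)) Finset.univ)))) && decide (j' = i)))) ℓ && κ ℓ)) Finset.univ)))) && decide (j' = i)))) = u := by
  have h := knf_ip_knfS_self hκ u
  funext j
  show ((u j ^^ ((decide (Odd (Finset.card (Finset.filter (fun ℓ => (u ℓ && κ ℓ)) Finset.univ)))) && decide (j = i))) ^^ ((decide (Odd (Finset.card (Finset.filter (fun ℓ => ((fun j' => (u j' ^^ ((decide (Odd (Finset.card (Finset.filter (fun ℓ => (u ℓ && κ ℓ)) Finset.univ)))) && decide (j' = i)))) ℓ && κ ℓ)) Finset.univ)))) && decide (j = i))) = u j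
  rw [h]
  cases u j <;> cases (decide (Odd (Finset.card (Finset.filter (fun ℓ => (u ℓ && κ ℓ)) Finset.univ)))) <;> cases decide (j = i) <;> rfl

/-- `P_{a,b}` is an involution. -/
theorem knfP_knfP (a b : Fin m) (x : Fin m → Bool) : (fun j' => (fun j' => x (Equiv.swap a b j')) (Equiv.swap a b j')) = x := by
  funext j; simp [Equiv.swap_apply_self]

/-- `T` is additive. -/
theorem knfT_bxor (i : Fin m) (κ x y : Fin m → Bool) :
    (fun j' => ((bxor x y) j' ^^ ((bxor x y) i && κ j'))) = bxor (fun j' => (x j' ^^ (x i && κ j'))) (fun j' => (y j' ^^ (y i && κ j'))) := by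
  funext j
  simp only [bxor]
  cases x j <;> cases y j <;> cases x i <;> cases y i <;> cases κ j <;> rfl

/-- `S` is additive. -/
theorem knfS_bxor (i : Fin m) (κ u v : Fin m → Bool) :
    (fun j' => ((bxor u v) j' ^^ ((decide (Odd (Finset.card (Finset.filter (fun ℓ => ((bxor u v) ℓ && κ ℓ)) Finset.univ)))) && decide (j' = i)))) = bxor (fun j' => (u j' ^^ ((decide (Odd (Finset.card (Finset.filter (fun ℓ => (u ℓ && κ ℓ)) Finset.univ)))) && decide (j' = i)))) (fun j' => (v j' ^^ ((decide (Odd (Finset.card (Finset.filter (fun ℓ => (v ℓ && κ ℓ)) Finset.univ)))) && decide (j' = i)))) := by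
  funext j
  rw [knf_ip_bxor_left]
  simp only [bxor]
  cases u j <;> cases v j <;> cases (decide (Odd (Finset.card (Finset.filter (fun ℓ => (u ℓ && κ ℓ)) Finset.univ)))) <;> cases (decide (Odd (Finset.card (Finset.filter (fun ℓ => (v ℓ && κ ℓ)) Finset.univ)))) <;> cases decide (j = i) <;> rfl

/-- `P` is additive. -/
theorem knfP_bxor (a b : Fin m) (x y : Fin m → Bool) :
    (fun j' => (bxor x y) (Equiv.swap a b j')) = bxor (fun j' => x (Equiv.swap a b j')) (fun j' => y (Equiv.swap a b j')) := rfl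

/-! ### Adjointness for the characters -/

/-- **`S_{i,κ}` and `T_{i,κ}` are adjoint**: `(-1)^{S u · T v} = (-1)^{u · v}` (for `κᵢ = 0`). -/
theorem knf_twist_knfS_knfT {i : Fin m} {κ : Fin m → Bool} (hκ : κ i = false) (u v : Fin m → Bool) :
    twist (fun j' => (u j' ^^ ((decide (Odd (Finset.card (Finset.filter (fun ℓ => (u ℓ && κ ℓ)) Finset.univ)))) && decide (j' = i)))) (fun j' => (v j' ^^ (v i && κ j'))) = twist u v := by
  have h1 : twist (fun j' => (u j' ^^ ((decide (Odd (Finset.card (Finset.filter (fun ℓ => (u ℓ && κ ℓ)) Finset.univ)))) && decide (j' = i)))) (fun j' => (v j' ^^ (v i && κ j'))) =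
      twist u v * twist u (fun j => v i && κ j) *
        (twist (fun j => (decide (Odd (Finset.card (Finset.filter (fun ℓ => (u ℓ && κ ℓ)) Finset.univ)))) && ((fun ℓ' => decide (ℓ' = i))) j) v *
          twist (fun j => (decide (Odd (Finset.card (Finset.filter (fun ℓ => (u ℓ && κ ℓ)) Finset.univ)))) && ((fun ℓ' => decide (ℓ' = i))) j) (fun j => v i && κ j)) := by
    rw [knfS_eq_bxor, knfT_eq_bxor, twist_bxor_left, twist_bxor_right, twist_bxor_right]
  have h2 : twist u (fun j => v i && κ j) = if v i then twist u κ else 1 :=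
    knf_twist_smul_right u κ (v i)
  have h3 : twist (fun j => (decide (Odd (Finset.card (Finset.filter (fun ℓ => (u ℓ && κ ℓ)) Finset.univ)))) && ((fun ℓ' => decide (ℓ' = i))) j) v = if (decide (Odd (Finset.card (Finset.filter (fun ℓ => (u ℓ && κ ℓ)) Finset.univ)))) then signOf (v i) else 1 := by
    rw [twist_comm, knf_twist_smul_right, knf_twist_E_right]
  have h4 : twist (fun j => (decide (Odd (Finset.card (Finset.filter (fun ℓ => (u ℓ && κ ℓ)) Finset.univ)))) && ((fun ℓ' => decide (ℓ' = i))) j) (fun j => v i && κ j) = 1 := by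
    rw [twist_comm, knf_twist_smul_right, knf_twist_E_right]
    simp [hκ, signOf]
  rw [h1, h2, h3, h4, ← knf_signOf_ip u κ]
  generalize (decide (Odd (Finset.card (Finset.filter (fun ℓ => (u ℓ && κ ℓ)) Finset.univ)))) = c
  cases c <;> cases v i <;> simp [signOf]

/-- … and in the other order (the adjointness relation is symmetric). -/
theorem knf_twist_knfT_knfS {i : Fin m} {κ : Fin m → Bool} (hκ : κ i = false) (u v : Fin m → Bool) :
    twist (fun j' => (u j' ^^ (u i && κ j'))) (fun j' => (v j' ^^ ((decide (Odd (Finset.card (Finset.filter (fun ℓ => (v ℓ && κ ℓ)) Finset.univ)))) && decide (j' = i)))) = twist u v := by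
  rw [twist_comm, knf_twist_knfS_knfT hκ, twist_comm]

/-- **`P_{a,b}` is self-adjoint** (orthogonal): `(-1)^{P u · P v} = (-1)^{u · v}`. -/
theorem knf_twist_knfP_knfP (a b : Fin m) (u v : Fin m → Bool) :
    twist (fun j' => u (Equiv.swap a b j')) (fun j' => v (Equiv.swap a b j')) = twist u v := by
  unfold twist
  exact Fintype.prod_equiv (Equiv.swap a b) _ _ fun l => rfl

/-! ### Following a linear functional through the coordinate changes -/

/-- `⟪T v, k⟫ = ⟪v, S k⟫`. -/
theorem knf_ip_knfT_left (i : Fin m) (κ v k : Fin m → Bool) :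
    (decide (Odd (Finset.card (Finset.filter (fun ℓ => ((fun j' => (v j' ^^ (v i && κ j'))) ℓ && k ℓ)) Finset.univ)))) = (decide (Odd (Finset.card (Finset.filter (fun ℓ => (v ℓ && (fun j' => (k j' ^^ ((decide (Odd (Finset.card (Finset.filter (fun ℓ => (k ℓ && κ ℓ)) Finset.univ)))) && decide (j' = i)))) ℓ)) Finset.univ)))) := by
  rw [knfT_eq_bxor, knfS_eq_bxor, knf_ip_bxor_left, knf_ip_bxor_right, knf_ip_smul_right,
    knf_ip_E_right, knf_ip_comm (fun j => v i && κ j) k, knf_ip_smul_right, knf_ip_comm k κ]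
  cases v i <;> cases (decide (Odd (Finset.card (Finset.filter (fun ℓ => (κ ℓ && k ℓ)) Finset.univ)))) <;> rfl

/-- `⟪S v, k⟫ = ⟪v, T k⟫`. -/
theorem knf_ip_knfS_left (i : Fin m) (κ v k : Fin m → Bool) :
    (decide (Odd (Finset.card (Finset.filter (fun ℓ => ((fun j' => (v j' ^^ ((decide (Odd (Finset.card (Finset.filter (fun ℓ => (v ℓ && κ ℓ)) Finset.univ)))) && decide (j' = i)))) ℓ && k ℓ)) Finset.univ)))) = (decide (Odd (Finset.card (Finset.filter (fun ℓ => (v ℓ && (fun j' => (k j' ^^ (k i && κ j'))) ℓ)) Finset.univ)))) := by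
  rw [knf_ip_comm, ← knf_ip_knfT_left, knf_ip_comm]

/-- `⟪P v, k⟫ = ⟪v, P k⟫`. -/
theorem knf_ip_knfP_left (a b : Fin m) (v k : Fin m → Bool) :
    (decide (Odd (Finset.card (Finset.filter (fun ℓ => ((fun j' => v (Equiv.swap a b j')) ℓ && k ℓ)) Finset.univ)))) = (decide (Odd (Finset.card (Finset.filter (fun ℓ => (v ℓ && (fun j' => k (Equiv.swap a b j')) ℓ)) Finset.univ)))) := by
  refine (knf_signOf_eq_signOf_iff _ _).1 ?_
  rw [knf_signOf_ip, knf_signOf_ip]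
  have h := knf_twist_knfP_knfP a b (fun j' => v (Equiv.swap a b j')) k
  rw [knfP_knfP] at h
  exact h.symm

/-! ### Special values -/

/-- `T_{i,κ} eᵢ = eᵢ ⊕ κ`. -/
theorem knfT_E (i : Fin m) (κ : Fin m → Bool) : (fun j' => ((fun ℓ' => decide (ℓ' = i)) j' ^^ ((fun ℓ' => decide (ℓ' = i)) i && κ j'))) = bxor (fun ℓ' => decide (ℓ' = i)) κ := by
  funext j; simp [bxor]

/-- `T_{i,κ}` fixes vectors with `xᵢ = 0`. -/
theorem knfT_of_apply_false {i : Fin m} (κ : Fin m → Bool) {x : Fin m → Bool} (hx : x i = false) :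
    (fun j' => (x j' ^^ (x i && κ j'))) = x := by
  funext j; simp [hx]

/-- `S_{i,κ}` fixes vectors orthogonal to `κ`. -/
theorem knfS_of_ip_false {i : Fin m} {κ u : Fin m → Bool} (hu : (decide (Odd (Finset.card (Finset.filter (fun ℓ => (u ℓ && κ ℓ)) Finset.univ)))) = false) :
    (fun j' => (u j' ^^ ((decide (Odd (Finset.card (Finset.filter (fun ℓ => (u ℓ && κ ℓ)) Finset.univ)))) && decide (j' = i)))) = u := by
  funext j
  show (u j ^^ ((decide (Odd (Finset.card (Finset.filter (fun ℓ => (u ℓ && κ ℓ)) Finset.univ)))) && decide (j = i))) = u j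
  rw [hu, Bool.false_and, Bool.xor_false]

/-- `S_{i,κ}` moves only the `i`-th coordinate. -/
theorem knfS_apply_ne {i j : Fin m} (hj : j ≠ i) (κ u : Fin m → Bool) : ((fun j' => (u j' ^^ ((decide (Odd (Finset.card (Finset.filter (fun ℓ => (u ℓ && κ ℓ)) Finset.univ)))) && decide (j' = i))))) j = u j := by
  simp [hj]

/-- `P_{a,b} e_c = e_{(a b) c}`. -/
theorem knfP_E (a b c : Fin m) : (fun j' => (fun ℓ' => decide (ℓ' = c)) (Equiv.swap a b j')) = (fun ℓ' => decide (ℓ' = (Equiv.swap a b c))) := by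
  funext j
  simp only []
  rw [decide_eq_decide]
  exact Equiv.swap_apply_eq_iff

/-- `P_{a,b}` fixes `e_c` for `c ∉ {a, b}`. -/
theorem knfP_E_of_ne {a b c : Fin m} (ha : c ≠ a) (hb : c ≠ b) : (fun j' => (fun ℓ' => decide (ℓ' = c)) (Equiv.swap a b j')) = (fun ℓ' => decide (ℓ' = c)) := by
  rw [knfP_E, Equiv.swap_apply_of_ne_of_ne ha hb]

end Summit.QuantumAdvantage.QuantumAdvantage.Theorems.SignedCubicForrelationNotPrBPP

end
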